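import Summits.QuantumFields.YangMills.Theorems.BalabanUVNodesN11CubeCoverRowOfNesting
import Summits.QuantumFields.YangMills.Theorems.BalabanUVNodesN11PartCompatOfCouplings
import Summits.QuantumFields.YangMills.Theorems.BalabanUVNodesK0TopIndexWrapGeometry

/-!
# DAG node N11 — ONE-BLOCK LEVELS: at a power-of-`L` basic cube every level of every run is EITHER partition-compatible OR ONE-BLOCK (its 𝐃_j-cube side EXCEEDS the torus
# period, the grid has the single index `0`, and that cube IS the torus); the geometry rows of the no-expansion 𝐓-step — K0b's saturation lemma, the nesting of the 𝐃-classes and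
# dag-n11-d's cube-cover binder `hcov` — hold in BOTH cases, hence at EVERY level WITHOUT the run guard `PartCompat₁₃`

HEADER — WORK-UNIT METADATA.  Cell `pub-ymgap`, YM-PLAN Track A (HUMAN RULING D-0062 ∕ D-0149 width seats), seat `pub-ymgap-dag-n11-w4` (g4; WIDTH SEAT 4 of 4 on NODE n11
[B14]), route `BalabanUVNodes`, item K1⁷ `StabilityBAtRecordR13SepCoPH` = stmt-QuantumFields-20542 (helper lane, `--kind proof --supports 20542 --as helper`, count-neutral).
[III] = [Balaban1988Convergent], [I] = [Balaban1987RG1].  Over this seat's g3 p606678 `…N11CubeCoverRowOfNesting` (§1 `subset_iUnion_cubesIn_of_mem_unionsOfCubes_mul` ∕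
`mem_unionsOfCubes_of_mem_unionsOfCubes_mul` ∕ §2 `cover_at_of_dvd_of_nesting`, all keyed on `s·t ∣ sitesPerDir 0`) and p608879 `…N11PartCompatOfCouplings` (`sitesPerDir_zero_eq`), K0b's
`Node00/Record12BgRowCubeGeometry` (`cubeEnl_subset_of_meets_unionsOfCubes`, `cubeIndices_bounds`), K0a's `Node00/Record13PartCompatOfSize` (`pow_dvd_two_mul_pow_of_le`), r12's
`B15Claim189CubePin` (`cubeOfSite`), and dag-n21-c's `…K0TopIndexWrapGeometry` (p≈55xxxx: `cubeEnl_zero_eq_univ_of_le` — a grid cube of side `≥ sitesPerDir 0` IS the torus — and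
`univ_mem_unionsOfCubes`, cited BY NAME, not restated; `Node00.empty_mem_unionsOfCubes`).

WHY THIS FILE.  This seat's g4 INTENT-1∕-3 LOCATED «the hole below the floor»: K1⁷'s consequent contains [III] Thm 1's conclusion for the record at runs whose last 𝐃-cube does not
fit the torus, where the no-expansion faces' run guard `PartCompat₁₃` fails.  THIS FILE shows that the GEOMETRIC inputs of those faces never needed the guard.  At `θ.τ9.M = F.L^a` every
cube side of record is a power of `L` (`R_j = L^{s_j}` by (2.5), `dCubeSide = L^{j+a+s_j}`; the torus period is `2·L^{m+K}`), so each level is EITHER compatible (`L^e ∣ 2L^{m+K}`,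
`e ≤ m+K`) OR ONE-BLOCK (`2L^{m+K} < L^e`) — §2's dichotomy.  In the one-block regime (§1: side `S ≥ sitesPerDir 0`) the grid `cubeIndices P S` is the single index `0` (ceil-division
`⌈T∕S⌉ = 1`), its cube `cubeEnl P S 0 n` IS the whole torus (every site's canonical lift lies in `[0, T−1]^d ⊆ [−nS, S−1+nS]^d`), every member of `unionsOfCubes P S` is `∅` or
`univ`, and therefore K0b's saturation conclusion («an `s`-cube meeting a union of `S`-cubes lies inside it»), the nesting of the classes and the cover of a `𝐃`-region by the (2.17)
cubes it contains all hold TRIVIALLY — print's graceful degeneration «the whole lattice is one block».  §3 states the three lemmas under the DISJUNCTION `S ∣ T ∨ T ≤ S`; §4 feeds the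
dichotomy: ★★★ dag-n11-d's binder `hcov` at EVERY level `1 ≤ j ≤ k` of EVERY run from the nesting numeric `L·M₂ ∣ M` and `M = L^a` ALONE — p606678's `cover_row_of_partCompat_of_nesting`
with `hPC` DELETED.  What remains guarded below the floor is therefore NOT geometry but K0's analytic proviso row `bg` ((2.28) at the background of record, guarded by the window AND
`PartCompat₁₃`) — the plan's ∕ K0a's ∕ def-T's object (in the one-block regime [15]'s local problem is the GLOBAL one of N07; worded, not typed here).

WHAT THIS FILE PROVES (0 `sorry`, 0 `def`; torus ∕ ℕ bookkeeping; nothing of Bałaban asserted).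
§1 one-block geometry (generic `P`, side `S` with `P.sitesPerDir 0 ≤ S`): `eq_zero_of_mem_cubeIndices_of_le` (the grid has the single index `0`) · ★
   `eq_empty_or_eq_univ_of_mem_unionsOfCubes_of_le` · ★★ `subset_of_meets_unionsOfCubes_of_le` · `mem_unionsOfCubes_of_mem_unionsOfCubes_of_le` ·
   `subset_iUnion_cubesIn_of_mem_unionsOfCubes_of_le` (over dag-n21-c's `cubeEnl_zero_eq_univ_of_le` ∕ `univ_mem_unionsOfCubes`).
§2 the dichotomy: `pow_dvd_two_mul_pow_or_lt` (`3 ≤ L`: `L^e ∣ 2L^n ∨ 2L^n < L^e`) · ★★ `dCubeSide_dvd_or_lt` (at `θ.τ9.M = F.L^a`: every level of every run is compatible or one-block) ·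
   ★★ `partCompat₁₃_or_exists_oneBlock` (every run: the guard up to `n`, or a one-block level `≤ n`) · `not_partCompat₁₃_of_oneBlock`.
§3 «compatible OR one-block» editions: ★★ `cubeEnl_subset_of_meets_unionsOfCubes_of_dvd_or_le` · `mem_unionsOfCubes_of_mem_unionsOfCubes_mul_of_dvd_or_le` ·
   `subset_iUnion_cubesIn_of_mem_unionsOfCubes_mul_of_dvd_or_le`.
§4 at the record: ★★ `cover_at_of_nesting_of_powM` (one level, no divisibility hypothesis) · ★★★ `cover_row_of_nesting_of_powM` (= dag-n11-d's `hcov` ∀ `1 ≤ j ≤ k`, from `L·M₂ ∣ M` and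
   `M = L^a` alone — NO `PartCompat₁₃`) · ★★★ `cover_row_theta13OfThm1CCMW` (at K1's witness θ₁₅ᶜᶜᴹᵂ(j; γ), `1 ≤ j`: UNCONDITIONAL).

HONEST FRAMING.  Helper lane of K1⁷; count-neutral kernel bookkeeping; nothing of [III]∕[I] asserted; NOT a discharge.  N11 NOT discharged; K1⁷ NOT closed; counts unmoved (typed
28∕28 · discharged 5∕27).  R4 closes only the conditional finite-𝕋⁴ rung `BalabanLadder.UV` of one programme at fixed `ε = L^{−K}` — NOT ℝ⁴, NOT OS, NOT a mass gap, NOT Clay.  No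
`sorry`, `axiom`, `def`, `instance`, `notation`.  Sources (SHAPE ∕ bookkeeping only): [III] (2.1) p.254, (2.5) p.255, (2.17)–(2.18) p.257 («partition … compatible with all other
partitions»); [I] (0.1) p.251.
-/

noncomputable section

open scoped BigOperators

namespace Summit.QuantumFields.YangMills.Theorems.BalabanUVNodesN11OneBlockLevels

open Literature.MathematicalPhysics.QuantumFieldTheory.Balaban1983to89 T4Continuum Node00 B14.Eq218Concrete
open B15Claim189CubePin (cubeOfSite mem_cubeEnl_cubeOfSite cubeOfSite_mem_cubeIndices)
open Summit.QuantumFields.YangMills.Theorems.K0TopIndexWrapGeometry (cubeEnl_zero_eq_univ_of_le univ_mem_unionsOfCubes)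
open BalabanUVNodesN11CubeCoverRowOfNesting (subset_iUnion_cubesIn_of_mem_unionsOfCubes_mul mem_unionsOfCubes_of_mem_unionsOfCubes_mul pos_of_mul_dvd_sitesPerDir
  dCubeSide_eq_cubeSide_mul)
open BalabanUVNodesN11PartCompatOfCouplings (sitesPerDir_zero_eq)

/-! ## §1  One-block geometry: a grid whose side is at least the torus period -/

section OneBlock

variable {P : Params}

/-- **IN THE ONE-BLOCK REGIME EVERY GRID INDEX IS `0`**: if `sitesPerDir 0 ≤ S` then `⌈sitesPerDir 0 ∕ S⌉ = 1`, so `cubeIndices P S ⊆ {0}` (with dag-n21-c's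
`zero_mem_cubeIndices`: `= {0}`). [cite: Balaban1988Convergent, (2.17) p.257 (bookkeeping: the cube grid of the tree's `cubeIndices`)] -/
theorem eq_zero_of_mem_cubeIndices_of_le {S : ℕ} (hS : P.sitesPerDir 0 ≤ S) {a : Fin P.d → ℤ} (ha : a ∈ cubeIndices P S) : a = 0 := by
  have hT : 1 ≤ P.sitesPerDir 0 := Nat.pos_of_ne_zero (P.sitesPerDir_ne_zero 0)
  have hq : (P.sitesPerDir 0 + S - 1) / S = 1 := Nat.div_eq_of_lt_le (by omega) (by omega)
  funext i
  have hb := cubeIndices_bounds ha i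
  rw [hq] at hb
  push_cast at hb
  simp only [Pi.zero_apply]
  omega

/-- **★ IN THE ONE-BLOCK REGIME A UNION OF GRID CUBES IS `∅` OR THE TORUS.** [cite: Balaban1988Convergent, p.254, (2.17) p.257 (bookkeeping)] -/
theorem eq_empty_or_eq_univ_of_mem_unionsOfCubes_of_le {S : ℕ} (hS : P.sitesPerDir 0 ≤ S) {Λ : Set (Site P 0)} (hΛ : Λ ∈ unionsOfCubes P S) :
    Λ = ∅ ∨ Λ = Set.univ := by
  obtain ⟨A, hA, rfl⟩ := hΛ
  rcases A.eq_empty_or_nonempty with hA0 | ⟨a, ha⟩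
  · left
    simp [hA0]
  · right
    have ha0 : a = 0 := eq_zero_of_mem_cubeIndices_of_le hS (hA ha)
    apply Set.eq_univ_of_univ_subset
    calc (Set.univ : Set (Site P 0)) = cubeEnl P S a 0 := by rw [ha0, cubeEnl_zero_eq_univ_of_le hS]
      _ ⊆ ⋃ a ∈ A, cubeEnl P S a 0 := Set.subset_iUnion₂ (s := fun a (_ : a ∈ A) => cubeEnl P S a 0) a ha

/-- **★★ ONE-BLOCK SATURATION**: in the one-block regime ANY set meeting a union of grid cubes lies inside it (the union is the torus). [cite: Balaban1988Convergent, p.257 (bookkeeping)] -/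
theorem subset_of_meets_unionsOfCubes_of_le {S : ℕ} (hS : P.sitesPerDir 0 ≤ S) {Λ : Set (Site P 0)} (hΛ : Λ ∈ unionsOfCubes P S)
    {X : Set (Site P 0)} (hne : (X ∩ Λ).Nonempty) : X ⊆ Λ := by
  rcases eq_empty_or_eq_univ_of_mem_unionsOfCubes_of_le hS hΛ with h | h
  · subst h
    simp at hne
  · subst h
    exact Set.subset_univ _

/-- **ONE-BLOCK NESTING**: in the one-block regime a union of `S`-cubes is a union of `s`-cubes for EVERY side `s > 0`. [cite: Balaban1988Convergent, (2.1) p.254, (2.17) p.257 (bookkeeping)] -/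
theorem mem_unionsOfCubes_of_mem_unionsOfCubes_of_le {S s : ℕ} (hS : P.sitesPerDir 0 ≤ S) (hs : 0 < s) {Λ : Set (Site P 0)}
    (hΛ : Λ ∈ unionsOfCubes P S) : Λ ∈ unionsOfCubes P s := by
  rcases eq_empty_or_eq_univ_of_mem_unionsOfCubes_of_le hS hΛ with h | h
  · subst h; exact Node00.empty_mem_unionsOfCubes P s
  · subst h; exact univ_mem_unionsOfCubes hs

/-- **ONE-BLOCK COVER**: in the one-block regime a union of `S`-cubes is covered by the `s`-cubes of the grid it contains (`s > 0`). [cite: Balaban1988Convergent, (2.17) p.257 (bookkeeping)] -/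
theorem subset_iUnion_cubesIn_of_mem_unionsOfCubes_of_le {S s : ℕ} (hS : P.sitesPerDir 0 ≤ S) (hs : 0 < s) {Λ : Set (Site P 0)}
    (hΛ : Λ ∈ unionsOfCubes P S) :
    Λ ⊆ ⋃ a ∈ cubesIn (fun a : ↥(cubeIndices P s) => cubeEnl P s a 0) Λ, cubeEnl P s a 0 := by
  intro x hx
  have ha : cubeOfSite s x ∈ cubeIndices P s := cubeOfSite_mem_cubeIndices s hs x
  have hxa : x ∈ cubeEnl P s (cubeOfSite s x) 0 := mem_cubeEnl_cubeOfSite s hs x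
  have hsub : cubeEnl P s (cubeOfSite s x) 0 ⊆ Λ := subset_of_meets_unionsOfCubes_of_le hS hΛ ⟨x, hxa, hx⟩
  exact Set.mem_iUnion₂.2 ⟨⟨cubeOfSite s x, ha⟩, (mem_cubesIn (fun a : ↥(cubeIndices P s) => cubeEnl P s a 0) Λ _).2 hsub, hxa⟩

end OneBlock

/-! ## §2  The dichotomy: at power-of-`L` sides every level is compatible or one-block -/

section Dichotomy

/-- **`L^e ∣ 2·L^n` OR `2·L^n < L^e`** (`3 ≤ L`): powers of `L` below `2L^n` divide it, the others exceed it. [cite: Balaban1987RG1, (0.1) p.251 (elementary)] -/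
theorem pow_dvd_two_mul_pow_or_lt {L : ℕ} (hL : 3 ≤ L) (e n : ℕ) : L ^ e ∣ 2 * L ^ n ∨ 2 * L ^ n < L ^ e := by
  rcases Nat.lt_or_ge (2 * L ^ n) (L ^ e) with h | h
  · exact Or.inr h
  · exact Or.inl (pow_dvd_two_mul_pow_of_le hL h)

variable {F : T4Family} {N : ℕ} [NeZero N]

/-- **★★ AT A POWER-OF-`L` BASIC CUBE EVERY LEVEL OF EVERY RUN IS COMPATIBLE OR ONE-BLOCK**: at `θ.τ9.M = F.L^a` the `𝐃_j`-cube side of record `L^j·M·R_j` (`R_j = L^{s_j}` by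
(2.5)) either divides the torus period `2L^{m+K}` or exceeds it — no run guard needed to know which rows apply. [cite: Balaban1988Convergent, (2.1) p.254, (2.5) p.255, p.257; Balaban1987RG1, (0.1) p.251] -/
theorem dCubeSide_dvd_or_lt (θ : Stage13Params F N) {a : ℕ} (hM : θ.τ9.M = F.L ^ a) (p : B12.RunParams) (j : ℕ) :
    dCubeSide (F.P p.K).L θ.τ9.M (RkOfRecord (F.P p.K).L θ.ν.r (gOfRecord₁₃ F N θ p j)) j ∣ (F.P p.K).sitesPerDir 0 ∨
      (F.P p.K).sitesPerDir 0 < dCubeSide (F.P p.K).L θ.τ9.M (RkOfRecord (F.P p.K).L θ.ν.r (gOfRecord₁₃ F N θ p j)) j := by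
  have hL3 : 3 ≤ F.L := by have := F.hL11; omega
  obtain ⟨s, hs, -, -⟩ := isRj_RkOfRecord (by omega : 2 ≤ F.L) θ.ν.r (gOfRecord₁₃ F N θ p j)
  rw [sitesPerDir_zero_eq]
  simp only [T4Family.P_L]
  have hside : dCubeSide F.L θ.τ9.M (RkOfRecord F.L θ.ν.r (gOfRecord₁₃ F N θ p j)) j = F.L ^ (j + a + s) := by
    rw [dCubeSide, hM, hs, pow_add, pow_add]
  rw [hside]
  exact pow_dvd_two_mul_pow_or_lt hL3 _ _

/-- **★★ EVERY RUN IS PARTITION-COMPATIBLE UP TO `n` OR HAS A ONE-BLOCK LEVEL `≤ n`** (at `θ.τ9.M = F.L^a`): the run guard fails exactly when some `𝐃_j`-cube, `1 ≤ j ≤ n`, exceeds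
the torus — «below the floor» of this seat's `…RunGuardIsCouplingFloor` = «has a one-block level». [cite: Balaban1988Convergent, (2.1) p.254, (2.5) p.255, p.257; Balaban1987RG1, (0.1) p.251] -/
theorem partCompat₁₃_or_exists_oneBlock (θ : Stage13Params F N) {a : ℕ} (hM : θ.τ9.M = F.L ^ a) (p : B12.RunParams) (n : ℕ) :
    PartCompat₁₃ F N θ p n ∨ ∃ j, 1 ≤ j ∧ j ≤ n ∧
      (F.P p.K).sitesPerDir 0 < dCubeSide (F.P p.K).L θ.τ9.M (RkOfRecord (F.P p.K).L θ.ν.r (gOfRecord₁₃ F N θ p j)) j := by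
  by_cases h : ∃ j, 1 ≤ j ∧ j ≤ n ∧ (F.P p.K).sitesPerDir 0 < dCubeSide (F.P p.K).L θ.τ9.M (RkOfRecord (F.P p.K).L θ.ν.r (gOfRecord₁₃ F N θ p j)) j
  · exact Or.inr h
  · refine Or.inl fun j h1 hj => (dCubeSide_dvd_or_lt θ hM p j).resolve_right fun hlt => h ⟨j, h1, hj, hlt⟩

/-- **… and a ONE-BLOCK LEVEL KILLS THE GUARD** (any `M`): a `𝐃_j`-cube exceeding the torus does not divide its period. [cite: Balaban1988Convergent, p.257 (bookkeeping)] -/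
theorem not_partCompat₁₃_of_oneBlock (θ : Stage13Params F N) (p : B12.RunParams) {n j : ℕ} (h1 : 1 ≤ j) (hj : j ≤ n)
    (hlt : (F.P p.K).sitesPerDir 0 < dCubeSide (F.P p.K).L θ.τ9.M (RkOfRecord (F.P p.K).L θ.ν.r (gOfRecord₁₃ F N θ p j)) j) :
    ¬ PartCompat₁₃ F N θ p n := fun h =>
  absurd (Nat.le_of_dvd (Nat.pos_of_ne_zero ((F.P p.K).sitesPerDir_ne_zero 0)) (h j h1 hj)) (not_le.mpr hlt)

end Dichotomy

/-! ## §3  «Compatible OR one-block» editions of K0b's saturation lemma and of p606678's nesting ∕ cover lemmas -/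

section Either

variable {P : Params}

/-- **★★ SATURATION, COMPATIBLE OR ONE-BLOCK**: an `s`-cube meeting a union `Λ` of `(s·t)`-cubes lies inside `Λ`, provided EITHER `s·t ∣ sitesPerDir 0` (K0b's
`cubeEnl_subset_of_meets_unionsOfCubes`: nested grids, no wrap) OR `sitesPerDir 0 ≤ s·t` (one block: `Λ = univ`). [cite: Balaban1988Convergent, p.257 («compatible with all other partitions»)] -/
theorem cubeEnl_subset_of_meets_unionsOfCubes_of_dvd_or_le {s t : ℕ} (hs : 0 < s) (ht : 0 < t) (h : s * t ∣ P.sitesPerDir 0 ∨ P.sitesPerDir 0 ≤ s * t)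
    {Λ : Set (Site P 0)} (hΛ : Λ ∈ unionsOfCubes P (s * t)) {a : Fin P.d → ℤ} (ha : a ∈ cubeIndices P s) (hne : (cubeEnl P s a 0 ∩ Λ).Nonempty) :
    cubeEnl P s a 0 ⊆ Λ := by
  rcases h with h | h
  · exact cubeEnl_subset_of_meets_unionsOfCubes hs ht h hΛ ha hne
  · exact subset_of_meets_unionsOfCubes_of_le h hΛ hne

/-- **NESTING, COMPATIBLE OR ONE-BLOCK**: a union of `(s·t)`-cubes is a union of `s`-cubes (`s, t > 0`), provided `s·t ∣ sitesPerDir 0` or `sitesPerDir 0 ≤ s·t`.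
[cite: Balaban1988Convergent, (2.1) p.254, (2.17) p.257 (bookkeeping)] -/
theorem mem_unionsOfCubes_of_mem_unionsOfCubes_mul_of_dvd_or_le {s t : ℕ} (hs : 0 < s) (h : s * t ∣ P.sitesPerDir 0 ∨ P.sitesPerDir 0 ≤ s * t)
    {Λ : Set (Site P 0)} (hΛ : Λ ∈ unionsOfCubes P (s * t)) : Λ ∈ unionsOfCubes P s := by
  rcases h with h | h
  · exact mem_unionsOfCubes_of_mem_unionsOfCubes_mul h hΛ
  · exact mem_unionsOfCubes_of_mem_unionsOfCubes_of_le h hs hΛ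

/-- **COVER, COMPATIBLE OR ONE-BLOCK**: a union of `(s·t)`-cubes is covered by the `s`-cubes of the grid it contains (`s > 0`), provided `s·t ∣ sitesPerDir 0` or
`sitesPerDir 0 ≤ s·t`. [cite: Balaban1988Convergent, (2.17) p.257 (bookkeeping)] -/
theorem subset_iUnion_cubesIn_of_mem_unionsOfCubes_mul_of_dvd_or_le {s t : ℕ} (hs : 0 < s) (h : s * t ∣ P.sitesPerDir 0 ∨ P.sitesPerDir 0 ≤ s * t)
    {Λ : Set (Site P 0)} (hΛ : Λ ∈ unionsOfCubes P (s * t)) :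
    Λ ⊆ ⋃ a ∈ cubesIn (fun a : ↥(cubeIndices P s) => cubeEnl P s a 0) Λ, cubeEnl P s a 0 := by
  rcases h with h | h
  · exact subset_iUnion_cubesIn_of_mem_unionsOfCubes_mul h hΛ
  · exact subset_iUnion_cubesIn_of_mem_unionsOfCubes_of_le h hs hΛ

end Either

/-! ## §4  At the record: the cube-cover binder `hcov` at EVERY level from the nesting numeric and `M = L^a` ALONE — no run guard -/

section Record

variable {F : T4Family} {N : ℕ} [NeZero N]

/-- **★★ ONE LEVEL, NO DIVISIBILITY HYPOTHESIS**: at `M = F.L^a` with `L·M₂ ∣ M`, a region of `𝐃_j` of record (a union of `L^j·M·R_j`-cubes) is covered by the `L^{j+1}·M₂·R_j`-cubes of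
the (2.17) partition it contains — at a compatible level by p606678's `cover_at_of_dvd_of_nesting`, at a one-block level because the region is `∅` or the torus (§2's dichotomy decides).
[cite: Balaban1988Convergent, (2.1) p.254, (2.5) p.255, (2.17) p.257] -/
theorem cover_at_of_nesting_of_powM (ν : Stage7Numerics) {M a : ℕ} (hMa : M = F.L ^ a) (g : ℕ → ℝ) (K j : ℕ) (hdiv : (F.P K).L * ν.M₂ ∣ M)
    {Ω : Set (Site (F.P K) 0)} (hΩ : Ω ∈ DOfRecord F ν M g K j) :
    Ω ⊆ ⋃ c ∈ cubesIn (fun c : ↥(cubeIndices (F.P K) (cubeSide (F.P K).L ν.M₂ (RkOfRecord (F.P K).L ν.r (g j)) j)) =>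
        cubeEnl (F.P K) (cubeSide (F.P K).L ν.M₂ (RkOfRecord (F.P K).L ν.r (g j)) j) c 0) Ω,
      cubeEnl (F.P K) (cubeSide (F.P K).L ν.M₂ (RkOfRecord (F.P K).L ν.r (g j)) j) c 0 := by
  have hL3 : 3 ≤ F.L := by have := F.hL11; omega
  obtain ⟨t, ht⟩ := hdiv
  have hside := dCubeSide_eq_cubeSide_mul ht (RkOfRecord (F.P K).L ν.r (g j)) j
  have hΩ' : Ω ∈ unionsOfCubes (F.P K) (cubeSide (F.P K).L ν.M₂ (RkOfRecord (F.P K).L ν.r (g j)) j * t) := by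
    have h' : Ω ∈ unionsOfCubes (F.P K) (dCubeSide (F.P K).L M (RkOfRecord (F.P K).L ν.r (g j)) j) := hΩ
    rwa [hside] at h'
  -- the big side is a power of `L`: compatible or one-block
  obtain ⟨s, hs, -, -⟩ := isRj_RkOfRecord (by show 2 ≤ F.L; omega) ν.r (g j)
  have hbig : dCubeSide (F.P K).L M (RkOfRecord (F.P K).L ν.r (g j)) j = F.L ^ (j + a + s) := by
    rw [dCubeSide, hMa, T4Family.P_L, hs, pow_add, pow_add]
  have hT : (F.P K).sitesPerDir 0 = 2 * F.L ^ (F.m + K) := by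
    have := sitesPerDir_zero_eq (F := F) ⟨K, 0, 0⟩
    exact this
  have hcases : cubeSide (F.P K).L ν.M₂ (RkOfRecord (F.P K).L ν.r (g j)) j * t ∣ (F.P K).sitesPerDir 0 ∨
      (F.P K).sitesPerDir 0 ≤ cubeSide (F.P K).L ν.M₂ (RkOfRecord (F.P K).L ν.r (g j)) j * t := by
    rw [← hside, hbig, hT]
    rcases pow_dvd_two_mul_pow_or_lt hL3 (j + a + s) (F.m + K) with h | h
    · exact Or.inl h
    · exact Or.inr h.le
  -- the small side is positive (`L ≥ 1`, `M₂ ≥ 1` from `L·M₂·t = M = L^a ≠ 0`, `R ≥ 1`)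
  have hM0 : 0 < M := by rw [hMa]; positivity
  have hsmall : 0 < cubeSide (F.P K).L ν.M₂ (RkOfRecord (F.P K).L ν.r (g j)) j := by
    rcases Nat.eq_zero_or_pos (cubeSide (F.P K).L ν.M₂ (RkOfRecord (F.P K).L ν.r (g j)) j) with h0 | h0
    · exfalso
      have : dCubeSide (F.P K).L M (RkOfRecord (F.P K).L ν.r (g j)) j = 0 := by rw [hside, h0, zero_mul]
      rw [hbig] at this
      exact absurd this (by positivity)
    · exact h0
  exact subset_iUnion_cubesIn_of_mem_unionsOfCubes_mul_of_dvd_or_le hsmall hcases hΩ'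

variable (θ : Stage13HParams F N) (p : B12.RunParams)

/-- **★★★ THE CUBE-COVER ROW OF THE NO-EXPANSION 𝐓-STEP FROM THE NESTING NUMERIC `L·M₂ ∣ M` AND `M = L^a` ALONE — NO RUN GUARD** (= p606678 `cover_row_of_partCompat_of_nesting` with
`hPC : PartCompat₁₃ θ p k` DELETED; conclusion = dag-n11-d's binder `hcov` of `…N11NoExpansionTStepZhPinOfSolvable` VERBATIM, all levels `1 ≤ j ≤ k`, every (2.18) index of length `j`).
[cite: Balaban1988Convergent, (2.1) p.254, (2.5) p.255, (2.17)–(2.18) p.257] -/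
theorem cover_row_of_nesting_of_powM (hdiv : (F.P p.K).L * θ.ν.M₂ ∣ θ.τ9.M) {a : ℕ} (hMa : θ.τ9.M = F.L ^ a) {k : ℕ} :
    ∀ j, 1 ≤ j → j ≤ k → ∀ s : SeqOfRecord F θ.ν θ.τ9.M (gOfRecord₁₃ F N θ.toStage13Params p) p.K j,
      s.Ω j ⊆ ⋃ c ∈ cubesIn (fun c : ↥(cubeIndices (F.P p.K) (cubeSide (F.P p.K).L θ.ν.M₂ (RkOfRecord (F.P p.K).L θ.ν.r (gOfRecord₁₃ F N θ.toStage13Params p j)) j)) =>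
          cubeEnl (F.P p.K) (cubeSide (F.P p.K).L θ.ν.M₂ (RkOfRecord (F.P p.K).L θ.ν.r (gOfRecord₁₃ F N θ.toStage13Params p j)) j) c 0) (s.Ω j),
        cubeEnl (F.P p.K) (cubeSide (F.P p.K).L θ.ν.M₂ (RkOfRecord (F.P p.K).L θ.ν.r (gOfRecord₁₃ F N θ.toStage13Params p j)) j) c 0 := by
  intro j h1 _ s
  exact cover_at_of_nesting_of_powM θ.ν hMa (gOfRecord₁₃ F N θ.toStage13Params p) p.K j hdiv (s.chain.memΩ j h1 le_rfl)

end Record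

/-! ## §5  At K1's witness of record `θ₁₅ᶜᶜᴹᵂ(j; γ)` (`M = L^j`, `M₂ = 1`): the cube-cover row is UNCONDITIONAL for `j ≥ 1` -/

section Witness

variable (F : T4Family) (N : ℕ) [NeZero N] (j : ℕ) (γ ε₀ ε₂₉ B₃ B₃' a₀ a₁ : ℝ)

/-- **★★★ AT θ₁₅ᶜᶜᴹᵂ(j; γ), `1 ≤ j`, THE CUBE-COVER ROW HOLDS ON EVERY RUN AT EVERY LEVEL** — no window, no run guard: nesting `L·M₂ ∣ M` is `L ∣ L^j` and `M = L^j` is dag-n21-c's `rfl`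
letter; every H-extension `θ` with `θ.toStage13Params = θ₁₅ᶜᶜᴹᵂ(j; γ)` inherits it (the row reads only `θ.ν`, `θ.τ9.M`, the couplings).
[cite: Balaban1988Convergent, (2.1) p.254, (2.5) p.255, (2.17)–(2.18) p.257; Balaban1989LargeFieldI, (2.1) p.182] -/
theorem cover_row_theta13OfThm1CCMW (θ : Stage13HParams F N) (hθ : θ.toStage13Params = theta13OfThm1CCMW F N j γ ε₀ ε₂₉ B₃ B₃' a₀ a₁) (hj : 1 ≤ j)
    (p : B12.RunParams) {k : ℕ} :
    ∀ i, 1 ≤ i → i ≤ k → ∀ s : SeqOfRecord F θ.ν θ.τ9.M (gOfRecord₁₃ F N θ.toStage13Params p) p.K i,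
      s.Ω i ⊆ ⋃ c ∈ cubesIn (fun c : ↥(cubeIndices (F.P p.K) (cubeSide (F.P p.K).L θ.ν.M₂ (RkOfRecord (F.P p.K).L θ.ν.r (gOfRecord₁₃ F N θ.toStage13Params p i)) i)) =>
          cubeEnl (F.P p.K) (cubeSide (F.P p.K).L θ.ν.M₂ (RkOfRecord (F.P p.K).L θ.ν.r (gOfRecord₁₃ F N θ.toStage13Params p i)) i) c 0) (s.Ω i),
        cubeEnl (F.P p.K) (cubeSide (F.P p.K).L θ.ν.M₂ (RkOfRecord (F.P p.K).L θ.ν.r (gOfRecord₁₃ F N θ.toStage13Params p i)) i) c 0 := by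
  have hM : θ.τ9.M = F.L ^ j := by
    show θ.toStage13Params.τ9.M = F.L ^ j
    rw [hθ]; exact theta13OfThm1CCMW_τ9_M F N j γ ε₀ ε₂₉ B₃ B₃' a₀ a₁
  have hM₂ : θ.ν.M₂ = 1 := by
    show θ.toStage13Params.ν.M₂ = 1
    rw [hθ]; exact theta13OfThm1CCMW_M₂ F N j γ ε₀ ε₂₉ B₃ B₃' a₀ a₁
  have hdiv : (F.P p.K).L * θ.ν.M₂ ∣ θ.τ9.M := by
    rw [hM₂, hM, T4Family.P_L, mul_one]
    exact dvd_pow_self F.L (by omega)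
  exact cover_row_of_nesting_of_powM θ p hdiv hM

end Witness

end Summit.QuantumFields.YangMills.Theorems.BalabanUVNodesN11OneBlockLevels

end
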